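import Literature.AlgebraicGeometry.Resolution.PointCentreFibreLine
import Literature.AlgebraicGeometry.Resolution.PointCentreFibreLineSwitch
import Literature.AlgebraicGeometry.Resolution.NearPointsPointCentreLineLocal
import Literature.AlgebraicGeometry.Resolution.RsopAdaptedShift
import Literature.AlgebraicGeometry.Resolution.PointBlowupOrder
import Literature.AlgebraicGeometry.Resolution.HypersurfaceTransform
import Literature.AlgebraicGeometry.Resolution.StalkIdealLemmas
import Literature.AlgebraicGeometry.Resolution.MarkedIdealsLemmas
import Literature.AlgebraicGeometry.Resolution.HironakaDirectrixVars
import HarnessLib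

/-!
# The `τ = 1` point step of [CoP1] Prop. 4.4: trichotomy of the near closed point (scheme → ring)

Topic: `Literature/AlgebraicGeometry/Resolution`. [CoP1] = Cossart–Piltant, J. Algebra 320 (2008), Lemma 4.3 (5)
and proof of Prop. 4.4, p. 12; CJS = Cossart–Jannsen–Saito, LNM 2270, Lemma 14.1. `π : X′ → X` the blowing
up of the locally Noetherian scheme `X` along the closed point `x = π x′` (`𝓘_{Y,x} = 𝔪_x = (c₀, c₁, c₂)`,
`𝒪_{X,x}` regular of dimension `3`), `c = (y, u₁, u₂)` a regular system of parameters ADAPTED to `(J, μ)` at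
the indices `≠ 0` (`τ(x) = 1`, `T_x = <Y₀>`), `x′` a NEAR point with `𝒪_{X′,x′}` regular of embedding
dimension `3` (a closed point of the fibre). Then `x′` lies on the line `{Y₀ = 0}` of `π⁻¹(x) = ℙ(𝔪_x/𝔪_x²)`
and, with `φ = π♯_{x′}` and the weak transform `J′_{x′} = ((J_x)𝒪_{x′} : φ(u)^μ)` read as a ring colon,
EXACTLY the three chart presentations consumed by the ring-level step theorems occur
(`IsBlowup.pointStep_trichotomy_of_stalkTau_eq_one`):
(i)/(ii) `x′` RATIONAL in the `u₁`-chart — for some `a ∈ 𝒪_{X,x}` the origin of the `u₁`-chart of the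
  sheared system `(y, u₁, u₂ − a u₁)` ([CoP1]: `x′ = (0:1:0)` resp. `(0:1:λ)`), and `k(x) → k(x′)` onto;
(iii) `x′` NON-RATIONAL in the `u₁`-chart — `u₂ = u₁ t`, `P ∈ 𝒪_{X,x}[T]` monic with `P̄` irreducible of
  degree `≥ 2`, third parameter `P(t)`, and `G(t) ∈ 𝔪_{x′} ⟺ P̄ ∣ Ḡ`;
(i′) `x′` the ORIGIN of the `u₂`-chart (`x′ = (0:0:1)`).
Proof: the chart dictionary `𝒪_{X′,x′} = (B_j)_𝔴` (`IsBlowup.exists_reesChart_stalk`), `j ≠ 0` and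
`e₀ = y/u_j ∈ 𝔴` because `x′` is near and `T_x = <Y₀>` (`ne_and_chartGen_mem_of_near_point_of_proj_mem_directrix`),
the ring-level dichotomy on the chart (`pointCentre_chart_dichotomy`, `PointCentreFibreLine.lean`), and for
`j = 2` away from the origin the switch to the `u₁`-chart (`PointCentreFibreLineSwitch.lean`); the stalk of
the weak transform is the ring colon by `stalkIdeal_colon` / `stalkIdeal_comap_eq_map_stalkMap`
(`stalkIdeal_controlledTransform_eq_colon_of_forall_eq_mul`).

Everything is PROVED (no `sorry`, no definitions, no named facts). OURS rendering of [CoP1]'s case list; the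
hypothesis `1 ≤ μ` is part of the agreed interface and not used by the proof. F-71 / T1 are NOT proved
here; no summit statement is proved. AI-written; AI checking is weaker than expert review.

## Sources

* V. Cossart, O. Piltant, J. Algebra 320 (2008), Lemma 4.3 (5); proof of Prop. 4.4, p. 12. [CossartPiltant2008]
* V. Cossart, U. Jannsen, S. Saito, LNM 2270 (2020), Lemma 14.1, Thm. 3.14. [CossartJannsenSaito2020]
* The Stacks Project, Tag 0804. [StacksProject]
-/

noncomputable section

open CategoryTheory AlgebraicGeometry TopologicalSpace IsLocalRing

namespace Literature.AlgebraicGeometry.Resolution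

universe u

open Scheme.IdealSheafData

variable {X X' : Scheme.{u}} {π : X' ⟶ X}

/-- **The stalk of the weak (controlled) transform is the ring colon by the exceptional parameter.** For any
morphism `π : X′ → X`, ideal sheaves `C, J` on `X`, `x′ ∈ X′`, and generators `c` of `C_{π x′}` with
`π♯(c_i) = π♯(c_j) · v_i` for all `i`: `(σᶜ(J, μ))_{x′} = (J_{π x′} 𝒪_{x′} : π♯(c_j)^μ)`.
[cite: CossartJannsenSaito2020, (4.1) and Lemma 4.7] -/
theorem stalkIdeal_controlledTransform_eq_colon_of_forall_eq_mul [IsLocallyNoetherian X']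
    (C J : X.IdealSheafData) (μ : ℕ) (x' : X') {k : ℕ} {c : Fin k → X.presheaf.stalk (π x')}
    (hcC : Ideal.span (Set.range c) = stalkIdeal C (π x')) (j : Fin k)
    (v : Fin k → X'.presheaf.stalk x') (hv : ∀ i, (π.stalkMap x').hom (c i) = (π.stalkMap x').hom (c j) * v i) :
    stalkIdeal (controlledTransform π C J μ) x' =
      Submodule.colon ((stalkIdeal J (π x')).map (π.stalkMap x').hom)
        ({(π.stalkMap x').hom (c j) ^ μ} : Set (X'.presheaf.stalk x')) := by
  have hCmap : (stalkIdeal C (π x')).map (π.stalkMap x').hom =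
      Ideal.span {(π.stalkMap x').hom (c j)} := by
    rw [← hcC]; exact Ideal.map_span_range_eq_span_singleton _ c j v hv
  rw [controlledTransform, stalkIdeal_colon, stalkIdeal_pow, stalkIdeal_comap_eq_map_stalkMap,
    stalkIdeal_comap_eq_map_stalkMap, hCmap, Ideal.span_singleton_pow, Ideal.colon_span]

set_option maxHeartbeats 800000 in
-- chart presentation of a stalk: large terms (as in `NearPointsPointCentreLineLocal`)
/-- **N2-σ — the `τ = 1` point-step trichotomy** (see the module docstring): the near closed point `x′` is
(i)/(ii) rational in the `u₁`-chart (origin after a shear `u₂ ↦ u₂ − a u₁`, residue fields equal), or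
(iii) non-rational in the `u₁`-chart (third parameter `P(u₂/u₁)`, `P̄` irreducible of degree `≥ 2`, with the
residue criterion), or (i′) the origin of the `u₂`-chart; in each case with generators of `𝔪_{x′}` and the
weak transform's stalk as the ring colon. (`hμ` belongs to the agreed interface; the proof does not need it.)
[cite: CossartPiltant2008, Lemma 4.3 (5); proof of Prop. 4.4, p. 12] [cite: CossartJannsenSaito2020, Lemma 14.1] -/
theorem IsBlowup.pointStep_trichotomy_of_stalkTau_eq_one [IsLocallyNoetherian X] [IsLocallyNoetherian X']
    {Y : Closeds X} (hπ : IsBlowup π (vanishingIdeal Y)) {J : X.IdealSheafData} {μ : ℕ} (hμ : 1 ≤ μ)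
    {x' : X'} [IsRegularLocalRing (X.presheaf.stalk (π x'))] [IsRegularLocalRing (X'.presheaf.stalk x')]
    (hd : (maximalIdeal (X.presheaf.stalk (π x'))).spanFinrank = 3)
    (hd' : (maximalIdeal (X'.presheaf.stalk x')).spanFinrank = 3)
    {c : Fin 3 → X.presheaf.stalk (π x')} (hc : Ideal.span (Set.range c) = maximalIdeal _)
    (hcY : Ideal.span (Set.range c) = stalkIdeal (vanishingIdeal Y) (π x'))
    (hτ : stalkTau J (π x') μ = 1) (had : ∀ i, i ≠ 0 → IsAdapted c (stalkIdeal J (π x')) μ i)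
    (hnear : IsNear π (vanishingIdeal Y) J μ x') :
    -- (i)/(ii): rational in the `u₁`-chart — origin after the shear `u₂ ↦ u₂ − a u₁`
    (∃ (a : X.presheaf.stalk (π x')) (c' : Fin 3 → X'.presheaf.stalk x'),
        c' 1 = (π.stalkMap x').hom (c 1) ∧
        (π.stalkMap x').hom (c 0) = (π.stalkMap x').hom (c 1) * c' 0 ∧
        (π.stalkMap x').hom (c 2 - a * c 1) = (π.stalkMap x').hom (c 1) * c' 2 ∧
        Ideal.span {c' 0, c' 1, c' 2} = maximalIdeal (X'.presheaf.stalk x') ∧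
        Function.Surjective (ResidueField.map (π.stalkMap x').hom) ∧
        stalkIdeal (controlledTransform π (vanishingIdeal Y) J μ) x' =
          Submodule.colon ((stalkIdeal J (π x')).map (π.stalkMap x').hom)
            ({(π.stalkMap x').hom (c 1) ^ μ} : Set (X'.presheaf.stalk x'))) ∨
    -- (iii): non-rational in the `u₁`-chart
    (∃ (t : X'.presheaf.stalk x') (P : Polynomial (X.presheaf.stalk (π x')))
        (c' : Fin 3 → X'.presheaf.stalk x'),
        c' 1 = (π.stalkMap x').hom (c 1) ∧
        (π.stalkMap x').hom (c 0) = (π.stalkMap x').hom (c 1) * c' 0 ∧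
        (π.stalkMap x').hom (c 2) = (π.stalkMap x').hom (c 1) * t ∧
        P.Monic ∧ c' 2 = Polynomial.eval₂ (π.stalkMap x').hom t P ∧
        2 ≤ (P.map (residue _)).natDegree ∧ Irreducible (P.map (residue _)) ∧
        (∀ G : Polynomial (X.presheaf.stalk (π x')),
          Polynomial.eval₂ (π.stalkMap x').hom t G ∈ maximalIdeal (X'.presheaf.stalk x') ↔
            P.map (residue _) ∣ G.map (residue _)) ∧
        Ideal.span {c' 0, c' 1, c' 2} = maximalIdeal (X'.presheaf.stalk x') ∧
        stalkIdeal (controlledTransform π (vanishingIdeal Y) J μ) x' =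
          Submodule.colon ((stalkIdeal J (π x')).map (π.stalkMap x').hom)
            ({(π.stalkMap x').hom (c 1) ^ μ} : Set (X'.presheaf.stalk x'))) ∨
    -- (i′): the origin of the `u₂`-chart
    (∃ c' : Fin 3 → X'.presheaf.stalk x',
        c' 2 = (π.stalkMap x').hom (c 2) ∧
        (π.stalkMap x').hom (c 0) = (π.stalkMap x').hom (c 2) * c' 0 ∧
        (π.stalkMap x').hom (c 1) = (π.stalkMap x').hom (c 2) * c' 1 ∧
        Ideal.span {c' 0, c' 1, c' 2} = maximalIdeal (X'.presheaf.stalk x') ∧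
        Function.Surjective (ResidueField.map (π.stalkMap x').hom) ∧
        stalkIdeal (controlledTransform π (vanishingIdeal Y) J μ) x' =
          Submodule.colon ((stalkIdeal J (π x')).map (π.stalkMap x').hom)
            ({(π.stalkMap x').hom (c 2) ^ μ} : Set (X'.presheaf.stalk x'))) := by
  classical
  have _hμ : 1 ≤ μ := hμ
  have hcm : ∀ i, c i ∈ maximalIdeal _ := fun i => hc ▸ Ideal.subset_span ⟨i, rfl⟩
  have hcq : IsQuasiRegular c := by
    have h := isQuasiRegular_rsop_comp hd c hc id Function.injective_id
    rwa [Function.comp_id] at h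
  -- STEP 1: the chart presentation of `x′`, its index `j ≠ 0`, and `e₀ ∈ 𝔴`
  obtain ⟨j, 𝔴, χ, hχ, hloc, h𝔴⟩ := hπ.exists_reesChart_stalk x' c hcY
  have h𝔴' : (maximalIdeal _).map (chartBase c j) ≤ 𝔴.asIdeal := by rw [← h𝔴]; exact Ideal.map_comap_le
  have hnearF : ∀ F : MvPolynomial (Fin 3) (X.presheaf.stalk (π x')), F.IsHomogeneous μ →
      MvPolynomial.eval c F ∈ stalkIdeal J (π x') →
      (algebraMap (chartRing c j) (Localization.AtPrime 𝔴.asIdeal) :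
          chartRing c j →+* Localization.AtPrime 𝔴.asIdeal)
          (MvPolynomial.eval₂Hom (chartBase c j) (fun i => chartGen c j i) F) ∈
        maximalIdeal (Localization.AtPrime 𝔴.asIdeal) ^ μ :=
    fun F hF hFJ => algebraMap_eval₂Hom_mem_pow_of_isNear hcY j 𝔴 χ hχ hloc hnear hF hFJ
  have hτc : hironakaTauAt c (stalkIdeal J (π x')) μ = 1 := by
    rw [← stalkTau_eq J (π x') μ hd c hc]; exact hτ
  obtain ⟨hj0, he0⟩ := ne_and_chartGen_mem_of_near_point_of_proj_mem_directrix hd c hc j 0 𝔴.asIdeal h𝔴'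
    hnearF (proj_mem_directrix_of_hironakaTauAt_eq_one c 0 hτc had)
  -- the relations `φ(c_i) = φ(c_j) · χ(e_i)` and the weak transform as a colon
  have hu : ∀ i, (π.stalkMap x').hom (c i) = (π.stalkMap x').hom (c j) * χ (chartGen c j i) :=
    fun i => by rw [← hχ, ← hχ, ← map_mul, ← reesChartBase_apply_eq_mul_chartGen c j i]
  have hcolon := stalkIdeal_controlledTransform_eq_colon_of_forall_eq_mul (π := π) (vanishingIdeal Y) J μ
    x' hcY j _ hu
  -- the third index `l` (`{0, j, l} = {0, 1, 2}`)
  obtain ⟨l, hl, hl0, hι⟩ : ∃ (l : Fin 3) (hl : l ≠ j), l ≠ 0 ∧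
      ∀ i : {i : Fin 3 // i ≠ j}, i.1 ≠ 0 → i = ⟨l, hl⟩ := by
    have key : ∀ j' : Fin 3, j' ≠ 0 → ∃ (l : Fin 3) (_ : l ≠ j'), l ≠ 0 ∧
        ∀ i : Fin 3, i ≠ j' → i ≠ 0 → i = l := by
      decide
    obtain ⟨l, hl, hl0, h⟩ := key j hj0
    exact ⟨l, hl, hl0, fun i hi => Subtype.ext (h i.1 i.2 hi)⟩
  -- STEP 2: the ring-level dichotomy on the chart `u_j ≠ 0`
  have heng := pointCentre_chart_dichotomy hd' hc hcq hj0 hl hl0 hι (π.stalkMap x').hom 𝔴.asIdeal χ hχ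
    hloc h𝔴 he0
  -- STEP 3: `j = 1` (the three `u₁`-chart shapes directly) or `j = 2` (origin, or switch to the `u₁`-chart)
  have hj12 : j = 1 ∨ j = 2 := by
    have key : ∀ j' : Fin 3, j' ≠ 0 → j' = 1 ∨ j' = 2 := by decide
    exact key j hj0
  rcases hj12 with rfl | rfl
  · have hl2 : l = 2 := by
      have key : ∀ l' : Fin 3, l' ≠ 1 → l' ≠ 0 → l' = 2 := by decide
      exact key l hl hl0
    subst hl2
    rcases heng with ⟨a, -, hgen, hsurj⟩ | ⟨P, hPm, hP2, hPi, hcrit, hgen⟩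
    · refine Or.inl ⟨a, ![χ (chartGen c 1 0), (π.stalkMap x').hom (c 1),
        χ (chartGen c 1 2) - (π.stalkMap x').hom a], rfl, hu 0, ?_, hgen, hsurj, hcolon⟩
      show (π.stalkMap x').hom (c 2 - a * c 1) =
        (π.stalkMap x').hom (c 1) * (χ (chartGen c 1 2) - (π.stalkMap x').hom a)
      rw [map_sub, map_mul, hu 2]; ring
    · exact Or.inr (Or.inl ⟨χ (chartGen c 1 2), P, ![χ (chartGen c 1 0), (π.stalkMap x').hom (c 1),
        Polynomial.eval₂ (π.stalkMap x').hom (χ (chartGen c 1 2)) P], rfl, hu 0, hu 2, hPm, rfl, hP2, hPi,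
        hcrit, hgen, hcolon⟩)
  · have hl1 : l = 1 := by
      have key : ∀ l' : Fin 3, l' ≠ 2 → l' ≠ 0 → l' = 1 := by decide
      exact key l hl hl0
    subst hl1
    rcases heng with ⟨a, ha, hgen, hsurj⟩ | ⟨P, hPm, hP2, hPi, hcrit, hgen⟩
    · rcases ha with rfl | haU
      · -- the origin of the `u₂`-chart
        refine Or.inr (Or.inr ⟨![χ (chartGen c 2 0), χ (chartGen c 2 1), (π.stalkMap x').hom (c 2)], rfl,
          hu 0, hu 1, ?_, hsurj, hcolon⟩)
        show Ideal.span {χ (chartGen c 2 0), χ (chartGen c 2 1), (π.stalkMap x').hom (c 2)} = _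
        rw [map_zero, sub_zero] at hgen
        rw [← hgen, Set.pair_comm (χ (chartGen c 2 1))]
      · -- rational, not the origin of the `u₂`-chart: switch to the `u₁`-chart
        obtain ⟨a', c', h1', h0', h2', hgen', hcol'⟩ := chartSwitch_rational (π.stalkMap x').hom haU (hu 0)
          (hu 1) hgen ((stalkIdeal J (π x')).map (π.stalkMap x').hom) μ
        exact Or.inl ⟨a', c', h1', h0', h2', hgen', hsurj, hcolon.trans hcol'⟩
    · -- non-rational in the `u₂`-chart: switch to the `u₁`-chart (reciprocal polynomial)
      obtain ⟨t, P', c', h1', h0', ht, hP'm, hc2, hP'2, hP'i, hcrit', hgen', hcol'⟩ :=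
        chartSwitch_nonRational (π.stalkMap x').hom (hu 0) (hu 1) hPm hP2 hPi hcrit hgen
          ((stalkIdeal J (π x')).map (π.stalkMap x').hom) μ
      exact Or.inr (Or.inl ⟨t, P', c', h1', h0', ht, hP'm, hc2, hP'2, hP'i, hcrit', hgen',
        hcolon.trans hcol'⟩)

/-! ## The bridge `δ → adapted`: σ with the adaptedness hypothesis spelled on initial forms -/

/-- **If every `μ`-initial form of `J` w.r.t. `c` is a scalar multiple of `Y_{j₀}^μ`, then `c` is adapted
(`e_i` lies in Hironaka's invariance space) at every index `i ≠ j₀`** — the translation `Y_i ↦ Y_i + T`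
fixes a form not involving `Y_i`. (Bridge from `forall_initialForms_of_lt_deltaS` (`δ > 1`) to `IsAdapted`.)
[cite: CossartJannsenSaito2020, Remark 2.9 (c)] [cite: CossartPiltant2008, §4 p. 11] -/
theorem isAdapted_of_forall_initialForms_eq_C_mul_X_pow {R : Type u} [CommRing R] [IsLocalRing R] {d : ℕ}
    (c : Fin d → R) (J : Ideal R) (μ : ℕ) (j₀ : Fin d)
    (h : ∀ G ∈ initialForms c J μ, ∃ a : ResidueField R,
      G = MvPolynomial.C a * MvPolynomial.X j₀ ^ μ)
    {i : Fin d} (hi : i ≠ j₀) : IsAdapted c J μ i := by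
  classical
  rw [IsAdapted, mem_invarianceSpace_iff]
  intro G hG
  obtain ⟨a, rfl⟩ := h G hG
  refine translate_rename_eq_of_forall_vars _ _ _ fun i' hi' => ?_
  have h1 := MvPolynomial.vars_mul _ _ hi'
  rw [Finset.mem_union, MvPolynomial.vars_C] at h1
  rcases h1 with h1 | h1
  · simp at h1
  · have h2 := MvPolynomial.vars_pow _ _ h1
    rw [MvPolynomial.vars_X, Finset.mem_singleton] at h2
    rw [h2, Pi.single_eq_of_ne (Ne.symm hi)]

/-- **N2-σ with the adaptedness hypothesis on initial forms** (the spelling of the T1 ring contract: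
`τ` as `hironakaTauAt c`, adapted as "every `μ`-initial form is `a · Y₀^μ`"): the same trichotomy as
`IsBlowup.pointStep_trichotomy_of_stalkTau_eq_one`.
[cite: CossartPiltant2008, Lemma 4.3 (5); proof of Prop. 4.4, p. 12] [cite: CossartJannsenSaito2020, Lemma 14.1] -/
theorem IsBlowup.pointStep_trichotomy_of_forall_initialForms [IsLocallyNoetherian X] [IsLocallyNoetherian X']
    {Y : Closeds X} (hπ : IsBlowup π (vanishingIdeal Y)) {J : X.IdealSheafData} {μ : ℕ} (hμ : 1 ≤ μ)
    {x' : X'} [IsRegularLocalRing (X.presheaf.stalk (π x'))] [IsRegularLocalRing (X'.presheaf.stalk x')]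
    (hd : (maximalIdeal (X.presheaf.stalk (π x'))).spanFinrank = 3)
    (hd' : (maximalIdeal (X'.presheaf.stalk x')).spanFinrank = 3)
    {c : Fin 3 → X.presheaf.stalk (π x')} (hc : Ideal.span (Set.range c) = maximalIdeal _)
    (hcY : Ideal.span (Set.range c) = stalkIdeal (vanishingIdeal Y) (π x'))
    (hτc : hironakaTauAt c (stalkIdeal J (π x')) μ = 1)
    (hadapt : ∀ G ∈ initialForms c (stalkIdeal J (π x')) μ,
      ∃ a : ResidueField (X.presheaf.stalk (π x')), G = MvPolynomial.C a * MvPolynomial.X 0 ^ μ)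
    (hnear : IsNear π (vanishingIdeal Y) J μ x') :
    -- (i)/(ii): rational in the `u₁`-chart — origin after the shear `u₂ ↦ u₂ − a u₁`
    (∃ (a : X.presheaf.stalk (π x')) (c' : Fin 3 → X'.presheaf.stalk x'),
        c' 1 = (π.stalkMap x').hom (c 1) ∧
        (π.stalkMap x').hom (c 0) = (π.stalkMap x').hom (c 1) * c' 0 ∧
        (π.stalkMap x').hom (c 2 - a * c 1) = (π.stalkMap x').hom (c 1) * c' 2 ∧
        Ideal.span {c' 0, c' 1, c' 2} = maximalIdeal (X'.presheaf.stalk x') ∧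
        Function.Surjective (ResidueField.map (π.stalkMap x').hom) ∧
        stalkIdeal (controlledTransform π (vanishingIdeal Y) J μ) x' =
          Submodule.colon ((stalkIdeal J (π x')).map (π.stalkMap x').hom)
            ({(π.stalkMap x').hom (c 1) ^ μ} : Set (X'.presheaf.stalk x'))) ∨
    -- (iii): non-rational in the `u₁`-chart
    (∃ (t : X'.presheaf.stalk x') (P : Polynomial (X.presheaf.stalk (π x')))
        (c' : Fin 3 → X'.presheaf.stalk x'),
        c' 1 = (π.stalkMap x').hom (c 1) ∧
        (π.stalkMap x').hom (c 0) = (π.stalkMap x').hom (c 1) * c' 0 ∧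
        (π.stalkMap x').hom (c 2) = (π.stalkMap x').hom (c 1) * t ∧
        P.Monic ∧ c' 2 = Polynomial.eval₂ (π.stalkMap x').hom t P ∧
        2 ≤ (P.map (residue _)).natDegree ∧ Irreducible (P.map (residue _)) ∧
        (∀ G : Polynomial (X.presheaf.stalk (π x')),
          Polynomial.eval₂ (π.stalkMap x').hom t G ∈ maximalIdeal (X'.presheaf.stalk x') ↔
            P.map (residue _) ∣ G.map (residue _)) ∧
        Ideal.span {c' 0, c' 1, c' 2} = maximalIdeal (X'.presheaf.stalk x') ∧
        stalkIdeal (controlledTransform π (vanishingIdeal Y) J μ) x' =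
          Submodule.colon ((stalkIdeal J (π x')).map (π.stalkMap x').hom)
            ({(π.stalkMap x').hom (c 1) ^ μ} : Set (X'.presheaf.stalk x'))) ∨
    -- (i′): the origin of the `u₂`-chart
    (∃ c' : Fin 3 → X'.presheaf.stalk x',
        c' 2 = (π.stalkMap x').hom (c 2) ∧
        (π.stalkMap x').hom (c 0) = (π.stalkMap x').hom (c 2) * c' 0 ∧
        (π.stalkMap x').hom (c 1) = (π.stalkMap x').hom (c 2) * c' 1 ∧
        Ideal.span {c' 0, c' 1, c' 2} = maximalIdeal (X'.presheaf.stalk x') ∧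
        Function.Surjective (ResidueField.map (π.stalkMap x').hom) ∧
        stalkIdeal (controlledTransform π (vanishingIdeal Y) J μ) x' =
          Submodule.colon ((stalkIdeal J (π x')).map (π.stalkMap x').hom)
            ({(π.stalkMap x').hom (c 2) ^ μ} : Set (X'.presheaf.stalk x'))) :=
  hπ.pointStep_trichotomy_of_stalkTau_eq_one hμ hd hd' hc hcY
    (by rw [stalkTau_eq J (π x') μ hd c hc]; exact hτc)
    (fun _ hi => isAdapted_of_forall_initialForms_eq_C_mul_X_pow c _ μ 0 hadapt hi) hnear

end Literature.AlgebraicGeometry.Resolution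

end
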